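import Literature.NumberTheory.Sieve.QuadraticRootsPrimeModuliDFISieveMiddle
import Literature.NumberTheory.Sieve.QuadraticRootsPrimeModuliDFISieveLegendre
import Literature.NumberTheory.Sieve.QuadraticRootsPrimeModuliDFISieveLeft
import HarnessLib

/-!
# Duke–Friedlander–Iwaniec 1995, §6: the master inequality behind Theorem 5

Topic `Literature/NumberTheory/Sieve`.  Towards the discharge of
`Literature.NumberTheory.Sieve.dukeFriedlanderIwaniec1995_theorem5` (W. Duke, J. B. Friedlander,
H. Iwaniec, Ann. of Math. 141 (1995), §6 pp. 433–437).  The four estimates of the companion files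
are combined along the identity of Lemma 1:
`∑_{p ≤ x} c_p = (∑_{p≤x} c_p − S(C, z)) + (S(C, w) − ∑_{w≤p<z} S(C_p, w)) + ∑_{w≤q<z} ∑_{q<p<z} S(C_{pq}, q)`
(Buchstab twice, `DFI1995.siftedQ_buchstab_twice`, and the exchange of the two primes), the double
sum being split at `q = y`:

* `DFI1995.norm_primeSum_le_master` — for `|c_n| ≤ τ(n)` and parameters
  `2 ≤ w < y ≤ z`, `4 ≤ z ≤ √x`, `x < z³`, `log y = (1/3 − ε) log x`, `0 < D ≤ x`, `K ≥ 1`,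
  `0 < ε ≤ 1/24`, `log x ≥ 16`, with `|R(D)| ≤ B₁` for all special bilinear forms (34) and
  `|R(w, y)| ≤ B₂` for all general bilinear forms (35) at this `x`:
  `|∑_{p ≤ x} c_p| ≤ T₀ + T₁ + T₂ + T₃`, the four explicit bounds of
  `DFI1995.norm_primeSum_sub_sifted_le` (`…DFISieveRough`), `DFI1995.norm_legendrePart_le`
  (`…DFISieveLegendre`), `DFI1995.norm_doubleSum_sub_le` (`…DFISieveMiddle`) and
  `DFI1995.norm_doubleSum_left_le` (`…DFISieveLeft`).

Theorem 5 itself (the choice `z = x^{1/2−3ε/2}`, `K = ⌊log x⌋⁵` and the verification that every term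
other than `O(ε x/log x)` is eventually smaller) is `…DFIProofs`.  Everything here is proved.

## References

* W. Duke, J. B. Friedlander, H. Iwaniec, Ann. of Math. (2) 141 (1995), 423–441, §6 Lemmas 1–3 and
  Theorem 5. [cite: DukeFriedlanderIwaniec1995, §6 Lemmas 1–3, Theorem 5]
-/

namespace Literature.NumberTheory.Sieve

open scoped BigOperators
open Finset Real

namespace DFI1995

noncomputable section

/-- **Lemma 1 as used for Theorem 5** (the identity (26) before any estimate, quotient convention):
`S(C, z) = (S(C, w) − ∑_{w≤p<z} S(C_p, w)) + ∑_{w≤q<z} ∑_{w≤p<z, q<p} S(C_{pq}, q)` for `w ≤ z`.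
[cite: DukeFriedlanderIwaniec1995, §6 p. 434 and Lemma 1 (26)] -/
theorem siftedQ_one_eq_legendre_add_doubleSum {M : Type*} [AddCommGroup M] (c : ℕ → M) (x : ℝ)
    {w z : ℝ} (hwz : w ≤ z) :
    siftedQ c x 1 z = (siftedQ c x 1 w - ∑ p ∈ primesIco w z, siftedQ c x p w) +
      ∑ q ∈ primesIco w z, ∑ p ∈ (primesIco w z).filter (fun p : ℕ => q < p), siftedQ c x (p * q) q := by
  rw [siftedQ_buchstab_twice c x 1 hwz]
  simp only [one_mul]
  rw [sum_primesIco_sum_primesIco_comm w z (fun p q => siftedQ c x (p * q) q)]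

/-- **The master inequality** (Lemmas 1–3 and the two estimates of p. 437 combined): for
`|c_n| ≤ τ(n)`, `0 < ε ≤ 1/24`, `1 < x`, `log x ≥ 16`, `2 ≤ w < y ≤ z`, `4 ≤ z ≤ √x`, `x < z³`,
`log y = (1/3 − ε) log x`, `0 < D ≤ x`, `K ≥ 1`, `|R(D)| ≤ B₁` for every special bilinear form (34)
and `|R(w, y)| ≤ B₂` for every general bilinear form (35) at this `x`,
`|∑_{p ≤ x} c_p| ≤ T₀ + T₁ + T₂ + T₃` with the explicit bounds of `DFI1995.norm_primeSum_sub_sifted_le`,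
`DFI1995.norm_legendrePart_le`, `DFI1995.norm_doubleSum_sub_le`, `DFI1995.norm_doubleSum_left_le`.
[cite: DukeFriedlanderIwaniec1995, §6 Lemmas 1–3, Theorem 5] -/
theorem norm_primeSum_le_master {c : ℕ → ℂ} (hc : ∀ n : ℕ, 1 ≤ n → ‖c n‖ ≤ (Nat.divisors n).card)
    {x w y z D ε B₁ B₂ : ℝ} {K : ℕ} (hε : 0 < ε) (hε' : ε ≤ 1 / 24) (hx : 1 < x) (hL : 16 ≤ Real.log x)
    (hw : 2 ≤ w) (hwy : w < y) (hyz : y ≤ z) (hz4 : 4 ≤ z) (hzs : z ≤ Real.sqrt x) (hxz : x < z ^ 3)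
    (hy : Real.log y = (1 / 3 - ε) * Real.log x) (hD : 0 < D) (hDx : D ≤ x) (hK : 0 < K)
    (hB₁ : ∀ lam : ℕ → ℂ, (∀ d : ℕ, ‖lam d‖ ≤ 1) → ‖sieveR₁ c lam x D‖ ≤ B₁)
    (hB₂ : ∀ α β : ℕ → ℂ, (∀ m : ℕ, ‖α m‖ ≤ ArithmeticFunction.cardDistinctFactors m) →
      (∀ n : ℕ, ‖β n‖ ≤ 1) → (∀ n : ℕ, ¬ n.Prime → β n = 0) → ‖sieveR₂ c α β x w y‖ ≤ B₂) :
    ‖∑ p ∈ Nat.primesLE ⌊x⌋₊, c p‖ ≤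
      (2 * z + 6 + 40 * (x / Real.log x) *
        (Real.log (Real.log (Real.sqrt x) / Real.log (z / 2)) + 16 / Real.log (z / 2))) +
      (2 * B₁ + (x * (1 + Real.log x)) *
        (Real.exp (-(Real.log 2 * Real.log D / Real.log w)) * Real.exp (4 * (Real.log (Real.log w) + 4))) +
        2 * (x * (1 + Real.log x)) * (Real.log (Real.log x) + 4) *
        (Real.exp (-(Real.log 2 * Real.log (D / z) / Real.log w)) *
          Real.exp (4 * (Real.log (Real.log w) + 4)))) +
      ((x * (1 + Real.log x)) * (w⁻¹ + Real.log (y / w) / K) * (Real.log (Real.log x) + 4) *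
          (4 + 8 * (Real.log (Real.log x) + 4)) + K * B₂) +
      (8 * (z + 1) ^ 2 + 160 * (x / Real.log x) * (12 * ε + 64 / Real.log x) * (6 * ε + 133 / Real.log x)) := by
  have hx0 : 0 < x := by linarith
  have hx1 : (1 : ℝ) ≤ x := hx.le
  have hzx : z ≤ x := by
    refine hzs.trans ?_
    rw [Real.sqrt_le_left hx0.le]
    nlinarith
  have hy0 : 0 < y := by linarith
  have hz0 : 0 ≤ z := by linarith
  have hwz : w ≤ z := hwy.le.trans hyz
  set P := ∑ p ∈ Nat.primesLE ⌊x⌋₊, c p with hP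
  set S := siftedQ c x 1 z with hS
  set Leg := siftedQ c x 1 w - ∑ p ∈ primesIco w z, siftedQ c x p w with hLeg
  set Dbl := ∑ q ∈ primesIco w z, ∑ p ∈ (primesIco w z).filter (fun p : ℕ => q < p),
    siftedQ c x (p * q) q with hDbl
  set Lft := ∑ q ∈ primesIco y z, ∑ p ∈ (primesIco w z).filter (fun p : ℕ => q < p),
    siftedQ c x (p * q) q with hLft
  have hid : S = Leg + Dbl := siftedQ_one_eq_legendre_add_doubleSum c x hwz
  have h0 := norm_primeSum_sub_sifted_le hc hz4 hzs hxz
  have h1 := norm_legendrePart_le hc hw hwz hzx hD hDx hB₁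
  have h2 := norm_doubleSum_sub_le hc hw hwy hyz hzx hK hB₂
  have h3 := norm_doubleSum_left_le hc (w := w) hε hε' hx hL hy0 hy hz0
  have hdecomp : P = (P - S) + Leg + (Dbl - Lft) + Lft := by rw [hid]; abel
  rw [hdecomp]
  calc ‖P - S + Leg + (Dbl - Lft) + Lft‖ ≤ ‖P - S‖ + ‖Leg‖ + ‖Dbl - Lft‖ + ‖Lft‖ := by
        refine (norm_add_le _ _).trans (add_le_add ((norm_add_le _ _).trans (add_le_add
          (norm_add_le _ _) le_rfl)) le_rfl)
    _ ≤ _ := add_le_add (add_le_add (add_le_add h0 h1) h2) h3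

end

end DFI1995

end Literature.NumberTheory.Sieve
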